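import Mathlib
import Summits.Ventures.PercRepro2.SwOutAll
import Summits.Ventures.PercRepro2.SwOutSeriesDefs
import Summits.Ventures.PercRepro2.SwOutSeriesContract
import Summits.Ventures.PercRepro2.SwOutSeriesContractCount
import Summits.Ventures.PercRepro2.SwOutSeriesDelete
import Summits.Ventures.PercRepro2.SwOutSeriesDeleteCount
import Summits.Ventures.PercRepro2.SwOutSeriesThm
import Summits.Ventures.PercRepro2.SwOutLeaf
import Summits.Ventures.PercRepro2.SwOutLeafThm
import Summits.Ventures.PercRepro2.SwOutLoop
import Summits.Ventures.PercRepro2.SwOutLoopThm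
import Summits.Ventures.PercRepro2.SwOutReducible
import Summits.Ventures.PercRepro2.SwOutArmFlip
import Summits.Ventures.PercRepro2.SwOutArms
import Summits.Ventures.PercRepro2.SwOutArmOrbit
import Summits.Ventures.PercRepro2.SwOutArmCube
import Summits.Ventures.PercRepro2.SwOutArmThm
import Summits.Ventures.PercRepro2.SwOutJunctionSplit
import Summits.Ventures.PercRepro2.SwOutJunctionFine
import Summits.Ventures.PercRepro2.SwOutJunctionRegion
import Summits.Ventures.PercRepro2.SwOutJunction
import Summits.Ventures.PercRepro2.SwOutJunctionsSplit
import Summits.Ventures.PercRepro2.SwOutJunctionsFine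
import Summits.Ventures.PercRepro2.SwOutJunctionsRegion
import Summits.Ventures.PercRepro2.SwOutJunctions

/-!
# Row (SW) from the multi-junction theorem (blind cell PercRepro2, night-4 g11, 2026-08-25;
proofs/NIGHT4-G11.md §5(3))

A region with an independent set of junctions is a base region of the series reduction
(`reducible_of_junctions`); hence row (SW) holds on every graph in which every vertex other than
`l, h, o` is joined to `l` or belongs to an independent set `J` of vertices (not joined to `l`,
without loops) whose neighbours other than `h` are all joined to `h` (**`sw_of_junctions`**).
Instance: the wheel `W₄` (hub `h`) with the apex `l` joined to two opposite rim vertices — the two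
other rim vertices are junctions (`sw_wheel_alt`).
-/

namespace Summit.Ventures.PercRepro2

namespace LocRows

open Hull

variable {V : Type*} {E : Type*} [Fintype E] [DecidableEq E]

open scoped Classical

variable {ends : E → Sym2 V} {l h o : V} {J : Set V}

/-- A region with an independent set of junctions is a base region of the series reduction. -/
theorem reducible_of_junctions {U : Set V} (hl : l ∉ U) (hloop_h : ∀ e, ends e ≠ s(h, h))
    (hJU : J ⊆ U) (hhJ : h ∉ J) (hind : IndepSet ends J)
    (hadj : ∀ u ∈ J, ∀ e (he : u ∈ ends e), Sym2.Mem.other he ≠ h →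
      ∃ e', ends e' = s(Sym2.Mem.other he, h))
    (hout : ∀ x ∈ U, x ≠ h → x ≠ o → x ∉ J →
      (∃ e y, ends e = s(x, y) ∧ y ∉ U) ∨ (∀ e, x ∉ ends e)) :
    Reducible l h o ends U :=
  Reducible.base ends U fun ξ _ h𝓔 =>
    rigidOK_of_junctions (ξ := ξ) hl hloop_h hJU hhJ hind hadj hout h𝓔

/-- **Row 2′SW-ALL on every graph with an independent set of junctions**: every vertex other
than `l, h, o` is joined to `l` or lies in `J`; `l, h ∉ J`; `J` independent, no loop at `h`; every
neighbour of a junction other than `h` is joined to `h`. -/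
theorem swAll_of_junctions (hlh : l ≠ h) (hloop_h : ∀ e, ends e ≠ s(h, h)) (hlJ : l ∉ J)
    (hhJ : h ∉ J) (hind : IndepSet ends J)
    (hadj : ∀ u ∈ J, ∀ e (he : u ∈ ends e), Sym2.Mem.other he ≠ h →
      ∃ e', ends e' = s(Sym2.Mem.other he, h))
    (hjoin : ∀ x, x ≠ l → x ≠ h → x ≠ o → x ∉ J → ∃ e, ends e = s(x, l)) : SwAll ends l h o := by
  have hJU : J ⊆ ({l}ᶜ : Set V) := by
    intro u hu
    simp only [Set.mem_compl_iff, Set.mem_singleton_iff]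
    rintro rfl
    exact hlJ hu
  refine swAll_of_reducible l h o hlh (reducible_of_junctions (by simp) hloop_h hJU hhJ hind hadj ?_)
  intro x hx hxh hxo hxJ
  obtain ⟨e, he⟩ := hjoin x (by simpa using hx) hxh hxo hxJ
  exact Or.inl ⟨e, l, he, by simp⟩

/-- **Row (SW) on every graph with an independent set of junctions** (see `swAll_of_junctions`). -/
theorem sw_of_junctions (hlh : l ≠ h) (hloop_h : ∀ e, ends e ≠ s(h, h)) (hlJ : l ∉ J)
    (hhJ : h ∉ J) (hind : IndepSet ends J)
    (hadj : ∀ u ∈ J, ∀ e (he : u ∈ ends e), Sym2.Mem.other he ≠ h →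
      ∃ e', ends e' = s(Sym2.Mem.other he, h))
    (hjoin : ∀ x, x ≠ l → x ≠ h → x ≠ o → x ∉ J → ∃ e, ends e = s(x, l)) : Sw ends l h o :=
  sw_of_swAll ends (swAll_of_junctions hlh hloop_h hlJ hhJ hind hadj hjoin)

/-! ## Instance: the wheel `W₄` with the apex joined to two opposite rim vertices -/

/-- The graph on `Fin 6`: the wheel with hub `1` and rim `2 3 4 5`, the apex `0` joined to the
rim vertices `2` and `4`; the rim vertices `3` and `5` are the junctions. -/
def wheelAlt : Fin 10 → Sym2 (Fin 6)
  | 0 => s(0, 2) | 1 => s(0, 4) | 2 => s(1, 2) | 3 => s(1, 3) | 4 => s(1, 4) | 5 => s(1, 5)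
  | 6 => s(2, 3) | 7 => s(3, 4) | 8 => s(4, 5) | 9 => s(5, 2)

/-- **Row (SW) on `wheelAlt`** with `l = 0`, `h = 1`, `o = 2` and the two junctions `3, 5`. -/
theorem sw_wheel_alt : Sw wheelAlt 0 1 2 := by
  refine sw_of_junctions (l := 0) (h := 1) (o := 2) (J := {3, 5}) (by decide) ?_ (by decide)
    (by decide) ?_ ?_ ?_
  · intro e; fin_cases e <;> decide
  · intro e x hx y hy
    simp only [Set.mem_insert_iff, Set.mem_singleton_iff] at hx hy
    fin_cases e <;> rcases hx with rfl | rfl <;> rcases hy with rfl | rfl <;> decide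
  · intro u hu e he hph
    simp only [Set.mem_insert_iff, Set.mem_singleton_iff] at hu
    rcases hu with rfl | rfl
    · fin_cases e
      · exact absurd he (by decide)
      · exact absurd he (by decide)
      · exact absurd he (by decide)
      · exact absurd (other_eq_of_ends he (p := 1) (by decide) (by decide)) hph
      · exact absurd he (by decide)
      · exact absurd he (by decide)
      · exact ⟨2, by rw [other_eq_of_ends he (p := 2) (by decide) (by decide)]; decide⟩
      · exact ⟨4, by rw [other_eq_of_ends he (p := 4) (by decide) (by decide)]; decide⟩
      · exact absurd he (by decide)
      · exact absurd he (by decide)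
    · fin_cases e
      · exact absurd he (by decide)
      · exact absurd he (by decide)
      · exact absurd he (by decide)
      · exact absurd he (by decide)
      · exact absurd he (by decide)
      · exact absurd (other_eq_of_ends he (p := 1) (by decide) (by decide)) hph
      · exact absurd he (by decide)
      · exact absurd he (by decide)
      · exact ⟨4, by rw [other_eq_of_ends he (p := 4) (by decide) (by decide)]; decide⟩
      · exact ⟨2, by rw [other_eq_of_ends he (p := 2) (by decide) (by decide)]; decide⟩
  · intro x hx0 hx1 hx2 hxJ
    simp only [Set.mem_insert_iff, Set.mem_singleton_iff, not_or] at hxJ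
    fin_cases x
    · exact absurd rfl hx0
    · exact absurd rfl hx1
    · exact absurd rfl hx2
    · exact absurd rfl hxJ.1
    · exact ⟨1, by rw [Sym2.eq_swap]; rfl⟩
    · exact absurd rfl hxJ.2

/-! ## The infinite family: the cone over `K_{k+1,k+1}` with the apex on one side -/

/-- The cone over the complete bipartite graph `K_{k+1,k+1}` (parts `a = inr (inl i)` and
`b = inr (inr j)`) with the hub `h = inl 1` and the apex `l = inl 0` joined to the part `a`: the
edges are `l − aᵢ`, `h − aᵢ`, `h − bⱼ` and `aᵢ − bⱼ`.  The `k + 1` vertices of the part `b` are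
junctions (pairwise non-adjacent, all their neighbours `aᵢ` joined to `h`). -/
def coneBip (k : ℕ) :
    Fin (k + 1) ⊕ Fin (k + 1) ⊕ Fin (k + 1) ⊕ (Fin (k + 1) × Fin (k + 1)) →
      Sym2 (Fin 2 ⊕ (Fin (k + 1) ⊕ Fin (k + 1)))
  | Sum.inl i => s(Sum.inl 0, Sum.inr (Sum.inl i))
  | Sum.inr (Sum.inl i) => s(Sum.inl 1, Sum.inr (Sum.inl i))
  | Sum.inr (Sum.inr (Sum.inl j)) => s(Sum.inl 1, Sum.inr (Sum.inr j))
  | Sum.inr (Sum.inr (Sum.inr p)) => s(Sum.inr (Sum.inl p.1), Sum.inr (Sum.inr p.2))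

/-- **Row (SW) on every cone over `K_{k+1,k+1}` with the apex on one side**, for every `o`: the
`k + 1` vertices of the other side are junctions of degree `k + 2`, not joined to `l` — up to
`k + 1` cores of `h` at once. -/
theorem sw_cone_bip (k : ℕ) (o : Fin 2 ⊕ (Fin (k + 1) ⊕ Fin (k + 1))) :
    Sw (coneBip k) (Sum.inl 0) (Sum.inl 1) o := by
  refine sw_of_junctions (l := Sum.inl 0) (h := Sum.inl 1) (o := o)
    (J := Set.range fun j : Fin (k + 1) => Sum.inr (Sum.inr j)) (by simp) ?_ (by simp) (by simp)
    ?_ ?_ ?_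
  · -- no loop at `h`
    rintro (i | i | j | p) h' <;> simp [coneBip] at h'
  · -- the junctions are independent
    rintro e x ⟨j, rfl⟩ y ⟨j', rfl⟩ h'
    rcases e with i | i | j'' | p <;> simp [coneBip] at h'
  · -- every neighbour of a junction other than `h` is joined to `h`
    rintro u ⟨j, rfl⟩ e he hph
    rcases e with i | i | j' | p
    · simp [coneBip] at he
    · simp [coneBip] at he
    · -- the edge `h − bⱼ'`: the other end is `h`
      exfalso
      apply hph
      simp only [coneBip, Sym2.mem_iff] at he
      rcases he with he | he
      · exact absurd he (by simp)
      · exact other_eq_of_ends _ (by simp only [coneBip]; rw [Sym2.eq_swap]; rw [Sum.inr.inj he])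
          (by simp)
    · -- the edge `aᵢ − bⱼ'`: the other end is `aᵢ`, joined to `h` by `inr (inl i)`
      simp only [coneBip, Sym2.mem_iff] at he
      rcases he with he | he
      · exact absurd he (by simp)
      · have hoth : Sym2.Mem.other (by assumption : Sum.inr (Sum.inr j) ∈ coneBip k
            (Sum.inr (Sum.inr (Sum.inr p)))) = Sum.inr (Sum.inl p.1) :=
          other_eq_of_ends _ (by simp only [coneBip]; rw [Sym2.eq_swap, Sum.inr.inj he]) (by simp)
        rw [hoth]
        exact ⟨Sum.inr (Sum.inl p.1), by simp [coneBip, Sym2.eq_swap]⟩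
  · -- every vertex other than `l, h, o` outside `J` is joined to `l`: the part `a`
    rintro (x | x | x) hx0 hx1 _ hxJ
    · fin_cases x
      · exact absurd rfl hx0
      · exact absurd rfl hx1
    · exact ⟨Sum.inl x, by simp [coneBip, Sym2.eq_swap]⟩
    · exact absurd ⟨x, rfl⟩ hxJ

end LocRows

end Summit.Ventures.PercRepro2
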